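import Summits.ResolutionOfSingularities.ResolutionOfSingularities.Theorems.FrobeniusClosingSteerConeTwoVertices
import Mathlib.Algebra.CharP.Algebra
import Mathlib.Algebra.CharP.Two
import HarnessLib

/-!
# Cone file 4 (W4.1, idea-3 CLAIM 6 / hNT4 support): base change of the descent space, and THREE VERTICES ⇒ SQUARE

W4.1, crux `Steer` (stmt-ResolutionOfSingularities-16345); the CLAIM-6 branches «unary ⇒ square» and «defined over κ» of
res-L0-w41-idea-3 g5's `HNT4-BLUEPRINT.md` §1 row C6 (res-L0-w41-plan-1 RULINGS 114d / 116b; res-D-pv-004 AS stub-10 assembles hNT4).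
Over the tree files `…DescentSpace*`, `…ConeBinary`, `…ConeShearVec`, `…ConeTwoVertices` (seat res-D-pv-007 AS res-L0-w41-stub-5):

* along any field homomorphism `f : κ →+* L` (base change `κ → κ̄`, or a Galois automorphism acting on coefficients):
  `map_genTransl`, **`isLineInvariant_map_iff`**, **`descentSpace_map_iff`** (`(f ∘ c) ∈ W_L(map f Φ) ⟺ c ∈ W_κ(Φ)`),
  **`isSquare_of_isSquare_map`** (κ perfect, char `2`: `map f Φ` a square ⇒ `Φ` a square — the «unary ⇒ square» exit);
* bookkeeping: `descentSpace_add_sq` (`W(Φ + Q²) = W(Φ)`), `mem_descentSpace_of_isLineInvariant`, `shearVec_add_smul`;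
* **THREE-VERTEX LEMMAS** (κ perfect, characteristic `2`): `exists_sq_isLineInvariant_triple` (three independent vectors in `W(Φ)` ⇒ ONE
  `Q`, an `n`-form when `Φ` is a `2n`-form, with `Φ + Q²` invariant along all three), its coordinate form
  `exists_coords_sq_support_free_three` (three shears: `θ Φ + Q²` free of `X_{i₁}, X_{i₂}, X_{i₃}`), and
  **`isSquare_of_three_vertices`**: in FOUR variables a `2n`-form which is a cone modulo squares over three independent vectors IS A SQUARE.
Not here: the Galois descent of the binary normal form from `κ̄` to `κ` (C6's last step; idea-3 / assembler). (research support for an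
idea card; candidates, not facts); nothing here is a statement of the manuscript under review [claim: Hironaka2017, status: under-review];
AI work, weaker than expert review. [cite: CossartPiltant2009, p. 9] [folklore]
-/

noncomputable section

-- `Summit.<S>.<S>.…` duplicates the summit name by design (single-problem summit).
set_option linter.dupNamespace false

open MvPolynomial
open Summit.ResolutionOfSingularities.ResolutionOfSingularities.Theorems.SwitchingDichotomy.DescentSpace

namespace Summit.ResolutionOfSingularities.ResolutionOfSingularities.Theorems.SwitchingDichotomy.Cone

universe u v w

section BaseChange

variable {κ : Type u} {L : Type w} [Field κ] [Field L] (f : κ →+* L) {σ : Type v}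

/-- **Descent of squareness along a field homomorphism, perfect source of characteristic `2`** (`f` any ring hom of fields, e.g.
`algebraMap κ L` or a field automorphism): if `map f Φ = R²` then `Φ` is a square over `κ`. [folklore] -/
theorem isSquare_of_isSquare_map [CharP κ 2] [PerfectField κ] (Φ : MvPolynomial σ κ)
    (h : IsSquare (MvPolynomial.map f Φ)) : IsSquare Φ := by
  classical
  haveI : CharP L 2 := charP_of_injective_ringHom f.injective 2
  obtain ⟨R, hR⟩ := h
  -- every monomial of `Φ` is a doubled exponent (read off over `L`)
  refine isSquare_of_forall_even Φ fun m hm j => ?_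
  have hm' : m ∈ (MvPolynomial.map f Φ).support := by
    rw [mem_support_iff, coeff_map]
    exact fun h0 => mem_support_iff.mp hm (f.injective (by rw [h0, map_zero]))
  rw [hR, ← sq] at hm'
  exact even_of_mem_support_sq R hm' j

/-- Base change of the generic translation along a field homomorphism `f`: `map (genTransl_κ c P) = genTransl_L (f ∘ c) (map P)`.
[folklore] -/
theorem map_genTransl (c : σ → κ) (P : MvPolynomial σ κ) :
    MvPolynomial.map (Polynomial.mapRingHom f) (genTransl κ c P) =
      genTransl L (fun i => f (c i)) (MvPolynomial.map f P) := by
  induction P using MvPolynomial.induction_on with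
  | C a =>
    rw [genTransl_C, map_C, map_C, genTransl_C]
    simp [Polynomial.mapRingHom]
  | add p q hp hq => rw [map_add, map_add, hp, hq, map_add, map_add]
  | mul_X p i hp =>
    rw [map_mul, map_mul, hp, map_mul, map_X, map_mul, genTransl_X, genTransl_X, map_add, map_X, map_C]
    congr 2
    simp [Polynomial.mapRingHom]

/-- **Line invariance is invariant under field homomorphisms** (base change `algebraMap κ L`, or a field automorphism acting on
coefficients; the direction vector is pushed forward by `f`). [folklore] -/
theorem isLineInvariant_map_iff (c : σ → κ) (P : MvPolynomial σ κ) :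
    IsLineInvariant L (fun i => f (c i)) (MvPolynomial.map f P) ↔ IsLineInvariant κ c P := by
  unfold IsLineInvariant
  rw [← map_genTransl, map_map]
  have hcomm : (algebraMap L (Polynomial L)).comp f = (Polynomial.mapRingHom f).comp (algebraMap κ (Polynomial κ)) := by
    ext a; simp [Polynomial.algebraMap_eq]
  rw [hcomm, ← map_map]
  constructor
  · intro h
    exact map_injective _ (Polynomial.map_injective _ f.injective) h
  · intro h; rw [h]

/-- **The descent space is invariant under field homomorphisms** (base change; Galois action on coefficients). [folklore] -/
theorem descentSpace_map_iff [Fintype σ] (c : σ → κ) (Φ : MvPolynomial σ κ) :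
    (fun i => f (c i)) ∈ descentSpace L (MvPolynomial.map f Φ) ↔ c ∈ descentSpace κ Φ := by
  unfold descentSpace
  simp only [Set.mem_setOf_eq]
  have hsum : (∑ i, f (c i) • pderiv i (MvPolynomial.map f Φ)) = MvPolynomial.map f (∑ i, c i • pderiv i Φ) := by
    rw [map_sum]
    refine Finset.sum_congr rfl fun i _ => ?_
    rw [pderiv_map, smul_eq_C_mul, smul_eq_C_mul, map_mul, map_C]
  rw [hsum, map_eq_zero_iff _ (map_injective _ f.injective)]
  refine and_congr_right fun _ => forall_congr' fun j => ?_
  rw [pderiv_map, isLineInvariant_map_iff]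

/-- In characteristic `2` the descent space only sees `dΦ`: `W(Φ + Q²) = W(Φ)`. [folklore] -/
theorem descentSpace_add_sq [CharP κ 2] [Fintype σ] (Φ Q : MvPolynomial σ κ) :
    descentSpace κ (Φ + Q ^ 2) = descentSpace κ Φ := by
  have hd : ∀ i, pderiv i (Φ + Q ^ 2) = pderiv i Φ := fun i => by
    rw [map_add, sq, Derivation.leibniz, smul_eq_mul, ← two_mul, ← mul_assoc,
      show (2 : MvPolynomial σ κ) = 0 from CharP.cast_eq_zero (MvPolynomial σ κ) 2 ▸ Nat.cast_two.symm,
      zero_mul, zero_mul, add_zero]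
  unfold descentSpace
  simp only [hd]

/-- A polynomial invariant along `c` has `c` in its descent space (any field: `Q = 0` in L2b's easy direction; here directly).
[folklore] -/
theorem mem_descentSpace_of_isLineInvariant [CharP κ 2] [PerfectField κ] [Fintype σ] [DecidableEq σ]
    {c : σ → κ} {Φ : MvPolynomial σ κ} (h : IsLineInvariant κ c Φ) : c ∈ descentSpace κ Φ :=
  (mem_descentSpace_iff_exists_sq Φ c).mpr ⟨0, by rw [zero_pow two_ne_zero, add_zero]; exact h⟩

end BaseChange

/-! ## Three vertices -/
section ThreeVertex

variable {κ : Type u} [Field κ] {σ : Type v} [DecidableEq σ]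

/-- The shear matrix `A_c` acts linearly on direction vectors. [folklore] -/
theorem shearVec_add_smul (c : σ → κ) (i₀ : σ) (a b : κ) (u w : σ → κ) :
    (fun i => if i = i₀ then c i₀ * (a • u + b • w) i₀ else (a • u + b • w) i + c i * (a • u + b • w) i₀) =
      a • (fun i => if i = i₀ then c i₀ * u i₀ else u i + c i * u i₀) +
        b • (fun i => if i = i₀ then c i₀ * w i₀ else w i + c i * w i₀) := by
  funext i
  by_cases hi : i = i₀
  · subst hi; simp only [if_true, Pi.add_apply, Pi.smul_apply, smul_eq_mul]; ring
  · simp only [if_neg hi, Pi.add_apply, Pi.smul_apply, smul_eq_mul]; ring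

variable [CharP κ 2] [Fintype σ] [PerfectField κ]

/-- **THREE-VERTEX LEMMA modulo squares** (C6's «three non-collinear vertices» branch; perfect field of characteristic `2`): three
linearly independent vectors in `W(Φ)` admit ONE common square correction `Q` with `Φ + Q²` invariant along all three (hence along
their span); `Q` is an `n`-form when `Φ` is a `2n`-form. (Three shears + `exists_sq_support_free_of_forall_single_mem`.) [folklore] -/
theorem exists_sq_isLineInvariant_triple {e₁ e₂ e₃ : σ → κ} {Φ : MvPolynomial σ κ} (he₁ : e₁ ≠ 0)
    (h12 : ∀ a : κ, e₂ ≠ a • e₁) (h123 : ∀ a b : κ, e₃ ≠ a • e₁ + b • e₂)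
    (h₁ : e₁ ∈ descentSpace κ Φ) (h₂ : e₂ ∈ descentSpace κ Φ) (h₃ : e₃ ∈ descentSpace κ Φ) :
    ∃ Q : MvPolynomial σ κ, (∀ n : ℕ, Φ.IsHomogeneous (2 * n) → Q.IsHomogeneous n) ∧
      IsLineInvariant κ e₁ (Φ + Q ^ 2) ∧ IsLineInvariant κ e₂ (Φ + Q ^ 2) ∧ IsLineInvariant κ e₃ (Φ + Q ^ 2) := by
  obtain ⟨i₁, hi₁⟩ : ∃ i, e₁ i ≠ 0 := Function.ne_iff.mp he₁
  -- shear 1: `e₁ ↦ E_{i₁}`; `e₂ ↦ v₂`, `e₃ ↦ v₃`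
  set v₂ : σ → κ := fun i => if i = i₁ then (e₁ i₁)⁻¹ * e₂ i₁ else e₂ i - e₁ i * (e₁ i₁)⁻¹ * e₂ i₁ with hv₂
  set v₃ : σ → κ := fun i => if i = i₁ then (e₁ i₁)⁻¹ * e₃ i₁ else e₃ i - e₁ i * (e₁ i₁)⁻¹ * e₃ i₁ with hv₃
  have hAv₂ : (fun i => if i = i₁ then e₁ i₁ * v₂ i₁ else v₂ i + e₁ i * v₂ i₁) = e₂ := shearVec_unshearVec hi₁ e₂
  have hAv₃ : (fun i => if i = i₁ then e₁ i₁ * v₃ i₁ else v₃ i + e₁ i * v₃ i₁) = e₃ := shearVec_unshearVec hi₁ e₃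
  obtain ⟨i₂, hi₂₁, hi₂⟩ := exists_ne_pivot_of_not_smul hi₁ h12
  set θ₁ : MvPolynomial σ κ →ₐ[κ] MvPolynomial σ κ :=
    aeval (fun i => if i = i₁ then C (e₁ i₁) * X i₁ else X i + C (e₁ i) * X i₁) with hθ₁
  set θ₁' : MvPolynomial σ κ →ₐ[κ] MvPolynomial σ κ :=
    aeval (fun i => if i = i₁ then C (e₁ i₁)⁻¹ * X i₁ else X i - C (e₁ i * (e₁ i₁)⁻¹) * X i₁) with hθ₁'
  have hE₁ : (Pi.single i₁ 1 : σ → κ) ∈ descentSpace κ (θ₁ Φ) := (mem_descentSpace_iff_shear hi₁ Φ).mp h₁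
  have hV₂ : v₂ ∈ descentSpace κ (θ₁ Φ) := mem_descentSpace_shear_of_vec (by rw [hAv₂]; exact h₂)
  have hV₃ : v₃ ∈ descentSpace κ (θ₁ Φ) := mem_descentSpace_shear_of_vec (by rw [hAv₃]; exact h₃)
  -- shear 2: `v₂ ↦ E_{i₂}` (fixes `E_{i₁}`); `v₃ ↦ w₃`
  set w₃ : σ → κ := fun i => if i = i₂ then (v₂ i₂)⁻¹ * v₃ i₂ else v₃ i - v₂ i * (v₂ i₂)⁻¹ * v₃ i₂ with hw₃
  have hAw₃ : (fun i => if i = i₂ then v₂ i₂ * w₃ i₂ else w₃ i + v₂ i * w₃ i₂) = v₃ := shearVec_unshearVec (c := v₂) (i₀ := i₂) hi₂ v₃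
  set θ₂ : MvPolynomial σ κ →ₐ[κ] MvPolynomial σ κ :=
    aeval (fun i => if i = i₂ then C (v₂ i₂) * X i₂ else X i + C (v₂ i) * X i₂) with hθ₂
  set θ₂' : MvPolynomial σ κ →ₐ[κ] MvPolynomial σ κ :=
    aeval (fun i => if i = i₂ then C (v₂ i₂)⁻¹ * X i₂ else X i - C (v₂ i * (v₂ i₂)⁻¹) * X i₂) with hθ₂'
  have hE₂ : (Pi.single i₂ 1 : σ → κ) ∈ descentSpace κ (θ₂ (θ₁ Φ)) := (mem_descentSpace_iff_shear (c := v₂) (i₀ := i₂) hi₂ _).mp hV₂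
  have hE₁' : (Pi.single i₁ 1 : σ → κ) ∈ descentSpace κ (θ₂ (θ₁ Φ)) :=
    mem_descentSpace_shear_of_vec (by rw [shearVec_single_of_ne v₂ hi₂₁.symm]; exact hE₁)
  have hW₃ : w₃ ∈ descentSpace κ (θ₂ (θ₁ Φ)) := mem_descentSpace_shear_of_vec (by rw [hAw₃]; exact hV₃)
  -- `w₃` has a non-zero coordinate off `{i₁, i₂}`
  obtain ⟨i₃, hi₃₁, hi₃₂, hi₃⟩ : ∃ i₃, i₃ ≠ i₁ ∧ i₃ ≠ i₂ ∧ w₃ i₃ ≠ 0 := by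
    by_contra hall
    push Not at hall
    -- then `w₃ = w₃ i₁ • E_{i₁} + w₃ i₂ • E_{i₂}`, so `v₃ = w₃ i₁ • E_{i₁} + w₃ i₂ • v₂` and `e₃ = w₃ i₁ • e₁ + w₃ i₂ • e₂`
    have hw : w₃ = w₃ i₁ • (Pi.single i₁ (1 : κ) : σ → κ) + w₃ i₂ • (Pi.single i₂ (1 : κ) : σ → κ) := by
      funext i
      by_cases h1 : i = i₁
      · subst h1; simp [hi₂₁.symm]
      · by_cases h2 : i = i₂
        · subst h2; simp [h1]
        · simp [h1, h2, hall i h1 h2]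
    apply h123 (w₃ i₁) (w₃ i₂)
    have hv : v₃ = w₃ i₁ • (Pi.single i₁ (1 : κ) : σ → κ) + w₃ i₂ • v₂ := by
      rw [← hAw₃]
      conv_lhs => rw [hw]
      rw [shearVec_add_smul, shearVec_single_of_ne v₂ hi₂₁.symm, shearVec_single_self]
    rw [← hAv₃]
    conv_lhs => rw [hv]
    rw [shearVec_add_smul, shearVec_single_self, hAv₂]
  -- shear 3: `w₃ ↦ E_{i₃}` (fixes `E_{i₁}`, `E_{i₂}`)
  set θ₃ : MvPolynomial σ κ →ₐ[κ] MvPolynomial σ κ :=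
    aeval (fun i => if i = i₃ then C (w₃ i₃) * X i₃ else X i + C (w₃ i) * X i₃) with hθ₃
  set θ₃' : MvPolynomial σ κ →ₐ[κ] MvPolynomial σ κ :=
    aeval (fun i => if i = i₃ then C (w₃ i₃)⁻¹ * X i₃ else X i - C (w₃ i * (w₃ i₃)⁻¹) * X i₃) with hθ₃'
  have hE₃ : (Pi.single i₃ 1 : σ → κ) ∈ descentSpace κ (θ₃ (θ₂ (θ₁ Φ))) :=
    (mem_descentSpace_iff_shear (c := w₃) (i₀ := i₃) hi₃ _).mp hW₃
  have hE₁'' : (Pi.single i₁ 1 : σ → κ) ∈ descentSpace κ (θ₃ (θ₂ (θ₁ Φ))) :=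
    mem_descentSpace_shear_of_vec (by rw [shearVec_single_of_ne w₃ hi₃₁.symm]; exact hE₁')
  have hE₂'' : (Pi.single i₂ 1 : σ → κ) ∈ descentSpace κ (θ₃ (θ₂ (θ₁ Φ))) :=
    mem_descentSpace_shear_of_vec (by rw [shearVec_single_of_ne w₃ hi₃₂.symm]; exact hE₂)
  -- one common square correction upstairs
  obtain ⟨Q₃, hQ₃hom, hQ₃⟩ := exists_sq_support_free_of_forall_single_mem (θ₃ (θ₂ (θ₁ Φ))) {i₁, i₂, i₃}
    (fun i hi => by
      rcases Finset.mem_insert.mp hi with rfl | hi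
      · exact hE₁''
      · rcases Finset.mem_insert.mp hi with rfl | hi
        · exact hE₂''
        · rw [Finset.mem_singleton.mp hi]; exact hE₃)
  have hZ : ∀ i ∈ ({i₁, i₂, i₃} : Finset σ), IsLineInvariant κ (Pi.single i 1) (θ₃ (θ₂ (θ₁ Φ)) + Q₃ ^ 2) :=
    fun i hi => isLineInvariant_single_of_forall i _ fun m hm => hQ₃ m hm i hi
  -- shear back, three times
  have back : ∀ {u : σ → κ} , IsLineInvariant κ u (θ₃ (θ₂ (θ₁ Φ)) + Q₃ ^ 2) →
      IsLineInvariant κ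
        (fun i => if i = i₁ then e₁ i₁ *
            (fun i => if i = i₂ then v₂ i₂ * (fun i => if i = i₃ then w₃ i₃ * u i₃ else u i + w₃ i * u i₃) i₂
              else (fun i => if i = i₃ then w₃ i₃ * u i₃ else u i + w₃ i * u i₃) i +
                v₂ i * (fun i => if i = i₃ then w₃ i₃ * u i₃ else u i + w₃ i * u i₃) i₂) i₁
          else (fun i => if i = i₂ then v₂ i₂ * (fun i => if i = i₃ then w₃ i₃ * u i₃ else u i + w₃ i * u i₃) i₂
              else (fun i => if i = i₃ then w₃ i₃ * u i₃ else u i + w₃ i * u i₃) i +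
                v₂ i * (fun i => if i = i₃ then w₃ i₃ * u i₃ else u i + w₃ i * u i₃) i₂) i +
            e₁ i * (fun i => if i = i₂ then v₂ i₂ * (fun i => if i = i₃ then w₃ i₃ * u i₃ else u i + w₃ i * u i₃) i₂
              else (fun i => if i = i₃ then w₃ i₃ * u i₃ else u i + w₃ i * u i₃) i +
                v₂ i * (fun i => if i = i₃ then w₃ i₃ * u i₃ else u i + w₃ i * u i₃) i₂) i₁)
        (Φ + (θ₁' (θ₂' (θ₃' Q₃))) ^ 2) := by
    intro u hu
    have h := isLineInvariant_unshear_of_vec (c := e₁) (i₀ := i₁) hi₁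
      (isLineInvariant_unshear_of_vec (c := v₂) (i₀ := i₂) hi₂
        (isLineInvariant_unshear_of_vec (c := w₃) (i₀ := i₃) hi₃ hu))
    rw [map_add, map_pow, map_add, map_pow, map_add, map_pow, hθ₃, unshear_shear (c := w₃) (i₀ := i₃) hi₃, hθ₂,
      unshear_shear (c := v₂) (i₀ := i₂) hi₂, hθ₁, unshear_shear (c := e₁) (i₀ := i₁) hi₁] at h
    exact h
  refine ⟨θ₁' (θ₂' (θ₃' Q₃)), fun n hΦ => ?_, ?_, ?_, ?_⟩
  · have hup : (θ₃ (θ₂ (θ₁ Φ))).IsHomogeneous (2 * n) :=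
      isHomogeneous_aeval_of_forall _ (isHomogeneous_shearForm w₃ i₃)
        (isHomogeneous_aeval_of_forall _ (isHomogeneous_shearForm v₂ i₂)
          (isHomogeneous_aeval_of_forall _ (isHomogeneous_shearForm e₁ i₁) hΦ))
    exact isHomogeneous_aeval_of_forall _ (isHomogeneous_unshearForm e₁ i₁)
      (isHomogeneous_aeval_of_forall _ (isHomogeneous_unshearForm v₂ i₂)
        (isHomogeneous_aeval_of_forall _ (isHomogeneous_unshearForm w₃ i₃) (hQ₃hom n hup)))
  · have h := back (hZ i₁ (by simp))
    rw [shearVec_single_of_ne w₃ hi₃₁.symm, shearVec_single_of_ne v₂ hi₂₁.symm, shearVec_single_self] at h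
    exact h
  · have h := back (hZ i₂ (by simp))
    rw [shearVec_single_of_ne w₃ hi₃₂.symm, shearVec_single_self, hAv₂] at h
    exact h
  · have h := back (hZ i₃ (by simp))
    rw [shearVec_single_self, hAw₃, hAv₃] at h
    exact h

/-- **Three vertices, coordinate form** (C6's non-collinear branch in coordinates): three independent vectors in `W(Φ)` give three distinct
indices and a linear change of coordinates `θ` (three shears; inverse `θ'`; both substitute linear forms) and ONE `Q` (an `n`-form when
`Φ` is a `2n`-form) such that `θ Φ + Q²` involves none of `X_{i₁}, X_{i₂}, X_{i₃}`. [folklore] -/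
theorem exists_coords_sq_support_free_three {e₁ e₂ e₃ : σ → κ} {Φ : MvPolynomial σ κ} (he₁ : e₁ ≠ 0)
    (h12 : ∀ a : κ, e₂ ≠ a • e₁) (h123 : ∀ a b : κ, e₃ ≠ a • e₁ + b • e₂)
    (h₁ : e₁ ∈ descentSpace κ Φ) (h₂ : e₂ ∈ descentSpace κ Φ) (h₃ : e₃ ∈ descentSpace κ Φ) :
    ∃ (i₁ i₂ i₃ : σ) (θ θ' : MvPolynomial σ κ →ₐ[κ] MvPolynomial σ κ) (Q : MvPolynomial σ κ),
      i₁ ≠ i₂ ∧ i₁ ≠ i₃ ∧ i₂ ≠ i₃ ∧ (∀ P, θ' (θ P) = P) ∧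
      (∀ i, (θ (X i)).IsHomogeneous 1) ∧ (∀ i, (θ' (X i)).IsHomogeneous 1) ∧
      (∀ n : ℕ, Φ.IsHomogeneous (2 * n) → Q.IsHomogeneous n) ∧
      ∀ m ∈ (θ Φ + Q ^ 2).support, m i₁ = 0 ∧ m i₂ = 0 ∧ m i₃ = 0 := by
  obtain ⟨i₁, hi₁⟩ : ∃ i, e₁ i ≠ 0 := Function.ne_iff.mp he₁
  set v₂ : σ → κ := fun i => if i = i₁ then (e₁ i₁)⁻¹ * e₂ i₁ else e₂ i - e₁ i * (e₁ i₁)⁻¹ * e₂ i₁ with hv₂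
  set v₃ : σ → κ := fun i => if i = i₁ then (e₁ i₁)⁻¹ * e₃ i₁ else e₃ i - e₁ i * (e₁ i₁)⁻¹ * e₃ i₁ with hv₃
  have hAv₂ : (fun i => if i = i₁ then e₁ i₁ * v₂ i₁ else v₂ i + e₁ i * v₂ i₁) = e₂ := shearVec_unshearVec hi₁ e₂
  have hAv₃ : (fun i => if i = i₁ then e₁ i₁ * v₃ i₁ else v₃ i + e₁ i * v₃ i₁) = e₃ := shearVec_unshearVec hi₁ e₃
  obtain ⟨i₂, hi₂₁, hi₂⟩ := exists_ne_pivot_of_not_smul hi₁ h12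
  set θ₁ : MvPolynomial σ κ →ₐ[κ] MvPolynomial σ κ :=
    aeval (fun i => if i = i₁ then C (e₁ i₁) * X i₁ else X i + C (e₁ i) * X i₁) with hθ₁
  set θ₁' : MvPolynomial σ κ →ₐ[κ] MvPolynomial σ κ :=
    aeval (fun i => if i = i₁ then C (e₁ i₁)⁻¹ * X i₁ else X i - C (e₁ i * (e₁ i₁)⁻¹) * X i₁) with hθ₁'
  have hE₁ : (Pi.single i₁ 1 : σ → κ) ∈ descentSpace κ (θ₁ Φ) := (mem_descentSpace_iff_shear hi₁ Φ).mp h₁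
  have hV₂ : v₂ ∈ descentSpace κ (θ₁ Φ) := mem_descentSpace_shear_of_vec (by rw [hAv₂]; exact h₂)
  have hV₃ : v₃ ∈ descentSpace κ (θ₁ Φ) := mem_descentSpace_shear_of_vec (by rw [hAv₃]; exact h₃)
  set w₃ : σ → κ := fun i => if i = i₂ then (v₂ i₂)⁻¹ * v₃ i₂ else v₃ i - v₂ i * (v₂ i₂)⁻¹ * v₃ i₂ with hw₃
  have hAw₃ : (fun i => if i = i₂ then v₂ i₂ * w₃ i₂ else w₃ i + v₂ i * w₃ i₂) = v₃ :=
    shearVec_unshearVec (c := v₂) (i₀ := i₂) hi₂ v₃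
  set θ₂ : MvPolynomial σ κ →ₐ[κ] MvPolynomial σ κ :=
    aeval (fun i => if i = i₂ then C (v₂ i₂) * X i₂ else X i + C (v₂ i) * X i₂) with hθ₂
  set θ₂' : MvPolynomial σ κ →ₐ[κ] MvPolynomial σ κ :=
    aeval (fun i => if i = i₂ then C (v₂ i₂)⁻¹ * X i₂ else X i - C (v₂ i * (v₂ i₂)⁻¹) * X i₂) with hθ₂'
  have hE₂ : (Pi.single i₂ 1 : σ → κ) ∈ descentSpace κ (θ₂ (θ₁ Φ)) :=
    (mem_descentSpace_iff_shear (c := v₂) (i₀ := i₂) hi₂ _).mp hV₂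
  have hE₁' : (Pi.single i₁ 1 : σ → κ) ∈ descentSpace κ (θ₂ (θ₁ Φ)) :=
    mem_descentSpace_shear_of_vec (by rw [shearVec_single_of_ne v₂ hi₂₁.symm]; exact hE₁)
  have hW₃ : w₃ ∈ descentSpace κ (θ₂ (θ₁ Φ)) := mem_descentSpace_shear_of_vec (by rw [hAw₃]; exact hV₃)
  obtain ⟨i₃, hi₃₁, hi₃₂, hi₃⟩ : ∃ i₃, i₃ ≠ i₁ ∧ i₃ ≠ i₂ ∧ w₃ i₃ ≠ 0 := by
    by_contra hall
    push Not at hall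
    have hw : w₃ = w₃ i₁ • (Pi.single i₁ (1 : κ) : σ → κ) + w₃ i₂ • (Pi.single i₂ (1 : κ) : σ → κ) := by
      funext i
      by_cases h1 : i = i₁
      · subst h1; simp [hi₂₁.symm]
      · by_cases h2 : i = i₂
        · subst h2; simp [h1]
        · simp [h1, h2, hall i h1 h2]
    apply h123 (w₃ i₁) (w₃ i₂)
    have hv : v₃ = w₃ i₁ • (Pi.single i₁ (1 : κ) : σ → κ) + w₃ i₂ • v₂ := by
      rw [← hAw₃]
      conv_lhs => rw [hw]
      rw [shearVec_add_smul, shearVec_single_of_ne v₂ hi₂₁.symm, shearVec_single_self]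
    rw [← hAv₃]
    conv_lhs => rw [hv]
    rw [shearVec_add_smul, shearVec_single_self, hAv₂]
  set θ₃ : MvPolynomial σ κ →ₐ[κ] MvPolynomial σ κ :=
    aeval (fun i => if i = i₃ then C (w₃ i₃) * X i₃ else X i + C (w₃ i) * X i₃) with hθ₃
  set θ₃' : MvPolynomial σ κ →ₐ[κ] MvPolynomial σ κ :=
    aeval (fun i => if i = i₃ then C (w₃ i₃)⁻¹ * X i₃ else X i - C (w₃ i * (w₃ i₃)⁻¹) * X i₃) with hθ₃'
  have hE₃ : (Pi.single i₃ 1 : σ → κ) ∈ descentSpace κ (θ₃ (θ₂ (θ₁ Φ))) :=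
    (mem_descentSpace_iff_shear (c := w₃) (i₀ := i₃) hi₃ _).mp hW₃
  have hE₁'' : (Pi.single i₁ 1 : σ → κ) ∈ descentSpace κ (θ₃ (θ₂ (θ₁ Φ))) :=
    mem_descentSpace_shear_of_vec (by rw [shearVec_single_of_ne w₃ hi₃₁.symm]; exact hE₁')
  have hE₂'' : (Pi.single i₂ 1 : σ → κ) ∈ descentSpace κ (θ₃ (θ₂ (θ₁ Φ))) :=
    mem_descentSpace_shear_of_vec (by rw [shearVec_single_of_ne w₃ hi₃₂.symm]; exact hE₂)
  obtain ⟨Q₃, hQ₃hom, hQ₃⟩ := exists_sq_support_free_of_forall_single_mem (θ₃ (θ₂ (θ₁ Φ))) {i₁, i₂, i₃}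
    (fun i hi => by
      rcases Finset.mem_insert.mp hi with rfl | hi
      · exact hE₁''
      · rcases Finset.mem_insert.mp hi with rfl | hi
        · exact hE₂''
        · rw [Finset.mem_singleton.mp hi]; exact hE₃)
  refine ⟨i₁, i₂, i₃, θ₃.comp (θ₂.comp θ₁), θ₁'.comp (θ₂'.comp θ₃'), Q₃, hi₂₁.symm, hi₃₁.symm, hi₃₂.symm,
    fun P => ?_, fun i => ?_, fun i => ?_, fun n hΦ => ?_, fun m hm => ?_⟩
  · change θ₁' (θ₂' (θ₃' (θ₃ (θ₂ (θ₁ P))))) = P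
    rw [hθ₃', hθ₃, unshear_shear (c := w₃) (i₀ := i₃) hi₃, hθ₂', hθ₂, unshear_shear (c := v₂) (i₀ := i₂) hi₂,
      hθ₁', hθ₁, unshear_shear (c := e₁) (i₀ := i₁) hi₁]
  · change (θ₃ (θ₂ (θ₁ (X i)))).IsHomogeneous 1
    rw [hθ₁, aeval_X]
    exact isHomogeneous_aeval_of_forall _ (isHomogeneous_shearForm w₃ i₃)
      (isHomogeneous_aeval_of_forall _ (isHomogeneous_shearForm v₂ i₂) (isHomogeneous_shearForm e₁ i₁ i))
  · change (θ₁' (θ₂' (θ₃' (X i)))).IsHomogeneous 1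
    rw [hθ₃', aeval_X]
    exact isHomogeneous_aeval_of_forall _ (isHomogeneous_unshearForm e₁ i₁)
      (isHomogeneous_aeval_of_forall _ (isHomogeneous_unshearForm v₂ i₂) (isHomogeneous_unshearForm w₃ i₃ i))
  · exact hQ₃hom n (isHomogeneous_aeval_of_forall _ (isHomogeneous_shearForm w₃ i₃)
      (isHomogeneous_aeval_of_forall _ (isHomogeneous_shearForm v₂ i₂)
        (isHomogeneous_aeval_of_forall _ (isHomogeneous_shearForm e₁ i₁) hΦ)))
  · exact ⟨hQ₃ m hm i₁ (by simp), hQ₃ m hm i₂ (by simp), hQ₃ m hm i₃ (by simp)⟩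

/-- **Three vertices in FOUR variables force a square** (C6's «three non-collinear vertices ⇒ unary ⇒ square» exit; perfect field of
characteristic `2`): a `2n`-form in four variables which is a cone modulo squares over three independent vectors is a square.
(In the coordinates of `exists_coords_sq_support_free_three`, `θΦ + Q²` is a `2n`-form in the one remaining variable, i.e. `c·X^{2n}`,
a square; so is `θΦ`, hence `Φ`.) [folklore] -/
theorem isSquare_of_three_vertices {e₁ e₂ e₃ : Fin 4 → κ} {Φ : MvPolynomial (Fin 4) κ} {n : ℕ} (hΦ : Φ.IsHomogeneous (2 * n))
    (he₁ : e₁ ≠ 0) (h12 : ∀ a : κ, e₂ ≠ a • e₁) (h123 : ∀ a b : κ, e₃ ≠ a • e₁ + b • e₂)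
    (h₁ : e₁ ∈ descentSpace κ Φ) (h₂ : e₂ ∈ descentSpace κ Φ) (h₃ : e₃ ∈ descentSpace κ Φ) : IsSquare Φ := by
  obtain ⟨i₁, i₂, i₃, θ, θ', Q, h12', h13', h23', hinv, hθ1, -, hQhom, hfree⟩ :=
    exists_coords_sq_support_free_three he₁ h12 h123 h₁ h₂ h₃
  -- `θ Φ + Q²` is a `2n`-form …
  have hθΦ : (θ Φ).IsHomogeneous (2 * n) := by
    have h := isHomogeneous_aeval_of_forall (fun i => θ (X i)) hθ1 hΦ
    have heq : aeval (fun i => θ (X i)) Φ = θ Φ := by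
      conv_rhs => rw [MvPolynomial.aeval_unique θ]
      rfl
    rwa [heq] at h
  have hform : (θ Φ + Q ^ 2).IsHomogeneous (2 * n) := by
    refine hθΦ.add ?_
    have := (hQhom n hΦ).pow 2
    rwa [mul_comm] at this
  -- … in the single remaining variable, hence all its exponents are even
  have heven : ∀ m ∈ (θ Φ + Q ^ 2).support, ∀ j, Even (m j) := by
    intro m hm j
    obtain ⟨hm1, hm2, hm3⟩ := hfree m hm
    by_cases hj : j = i₁ ∨ j = i₂ ∨ j = i₃
    · rcases hj with rfl | rfl | rfl
      · rw [hm1]; exact Even.zero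
      · rw [hm2]; exact Even.zero
      · rw [hm3]; exact Even.zero
    · push Not at hj
      obtain ⟨hj1, hj2, hj3⟩ := hj
      -- the four indices exhaust `Fin 4`
      have huniv : ({i₁, i₂, i₃, j} : Finset (Fin 4)) = Finset.univ := by
        apply Finset.eq_univ_of_card
        rw [Finset.card_insert_of_notMem (by simp [h12', h13', Ne.symm hj1]),
          Finset.card_insert_of_notMem (by simp [h23', Ne.symm hj2]),
          Finset.card_insert_of_notMem (by simp [Ne.symm hj3]), Finset.card_singleton, Fintype.card_fin]
      have hothers : ∀ k, k ≠ j → m k = 0 := by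
        intro k hk
        have hk' : k ∈ ({i₁, i₂, i₃, j} : Finset (Fin 4)) := by rw [huniv]; exact Finset.mem_univ k
        simp only [Finset.mem_insert, Finset.mem_singleton] at hk'
        rcases hk' with rfl | rfl | rfl | rfl
        · exact hm1
        · exact hm2
        · exact hm3
        · exact absurd rfl hk
      have hdeg := (isHomogeneous_iff_forall_mem_support _ _).mp hform m hm
      rw [Finsupp.sum_fintype _ _ (fun _ => rfl), Finset.sum_eq_single j (fun k _ hk => hothers k hk)
        (fun h => absurd (Finset.mem_univ j) h)] at hdeg
      exact ⟨n, by omega⟩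
  obtain ⟨R, hR⟩ := exists_sq_eq_of_forall_even (θ Φ + Q ^ 2) heven
  -- `θ Φ = R² + Q² = (R + Q)²`, and pull back along `θ'`
  have hθΦsq : θ Φ = (R + Q) ^ 2 := by
    rw [add_pow_char, hR]
    have h2 : (Q ^ 2 + Q ^ 2 : MvPolynomial (Fin 4) κ) = 0 := CharTwo.add_self_eq_zero _
    linear_combination (-1 : MvPolynomial (Fin 4) κ) * h2
  refine ⟨θ' (R + Q), ?_⟩
  rw [← sq, ← map_pow, ← hθΦsq, hinv]

end ThreeVertex

end Summit.ResolutionOfSingularities.ResolutionOfSingularities.Theorems.SwitchingDichotomy.Cone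

end
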